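import Summits.Ventures.WeilGRH.TwistedGramEntryBox
import HarnessLib

/-!
# GRH arm (rh-explicit, venture WeilGRH): twisted format C — kernel boxes of the door's two scalar constants
  (brick (E3b) of the χ instance lane: `CC ∋ a(1 + weilArchDensity(2a))` and `AOP ∋ A_op⁺(a)`)

Cell `rh-explicit`, WEIL TRACK — GRH ARM (engine seat weil-grh-2 gen7).  The cell checkers (`TwistedGramCellCheck*.lean`) take two
scalar boxes as input: `CC ∋ C = a(1 + E(2a))`, `E(t) = weilArchDensity t = e^{t/2}/(2 sinh t)`, and `AOP ∋ A_op⁺(a) =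
Σ_{log k<2a} Λ(k)k^{-1/2}·2cos(π/(⌊2a/log k⌋ + 2))` (the path-graph bound of the compressed prime operator).  Here they are
computed by the kernel from the `ζ` lane's constants record (`Encl.Consts`: `A ∋ a`, `P ∋ π`, `lens`, `wts`) with the tree's
multi-precision engine (`MI.exp`, `MI.divPos`, `MC.expI`):

* `ccBox S K k C = some CC` ⇒ `a(1 + weilArchDensity(2a)) ∈ CC` (`mem_ccBox`; `2 sinh 2a = e^{2a} − e^{−2a}`);
* `aopBox S K k C ns = some AOP` with `checkFloors S C ns = true` (`n_i·ℓ_i ≤ 2a < (n_i+1)·ℓ_i` decided on the boxes, so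
  `⌊2a/log k_i⌋ = n_i`) ⇒ `A_op⁺(a) ∈ AOP` (`mem_aopBox`).  At `a = log 2` the ratio `2a/log 2 = 2` is an integer and
  `checkFloors` cannot succeed — certify such cells at `18/25 ⊃ log 2` instead (FORMATC-CHI-LANE.md §5).

Everything is PROVED; computable `def`s; no named facts; RH/GRH-free.  References: H. Yoshida (1992) §7
[Yoshida1992HermitianForms]; R. E. Moore (1966) Ch. 3 [Moore1966].
-/

set_option autoImplicit false

open Real Complex Finset
open scoped BigOperators ArithmeticFunction.vonMangoldt

namespace Summit.Ventures.WeilGRH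

open Literature.NumberTheory.LFunctions Literature.NumberTheory.LFunctions.Yoshida1992
open Literature.NumberTheory.LFunctions.Yoshida1992.Encl
open Literature.Analysis.SpecialFunctions Literature.Analysis.ValidatedNumerics.NumericsMP

namespace TwistedEncl

variable {S : ℕ} {a : ℝ}

/-! ## `CC ∋ a(1 + weilArchDensity(2a))` -/

/-- Box of `a(1 + e^{a}/(e^{2a} − e^{−2a}))` (`K` series terms, `k` argument halvings for `exp`). [cite: Moore1966, Ch. 3 (interval arithmetic: inclusion property)] -/
def ccBox (S K k : ℕ) (C : Consts) : Option MI :=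
  match MI.exp S K k C.A, MI.exp S K k (C.A.mulInt 2), MI.exp S K k (C.A.mulInt (-2)) with
  | some X1, some X2, some X3 =>
    match MI.divPos S X1 (X2.sub X3) with
    | some E => some (C.A.mul S ((MI.ofInt S 1).add E))
    | none => none
  | _, _, _ => none

/-- `weilArchDensity(2a) = e^{a}/(e^{2a} − e^{−2a})`. [cite: Bombieri2000Weil, Thm 2 (p. 193)] -/
theorem weilArchDensity_two_mul (a : ℝ) :
    weilArchDensity (2 * a) = Real.exp a / (Real.exp (2 * a) - Real.exp (-(2 * a))) := by
  unfold weilArchDensity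
  rw [Real.sinh_eq]
  congr 1
  · congr 1; ring
  · ring

/-- Soundness of `ccBox`. [cite: Moore1966, Ch. 3 (interval arithmetic: inclusion property)] -/
theorem mem_ccBox (hS : 0 < S) {ks : List PrimeLen} {C : Consts} (hC : ConstsValid S a ks C) {K k : ℕ} {CC : MI}
    (h : ccBox S K k C = some CC) : MI.mem S (a * (1 + weilArchDensity (2 * a))) CC := by
  unfold ccBox at h
  split at h
  · rename_i X1 X2 X3 h1 h2 h3
    split at h
    · rename_i E hE
      simp only [Option.some.injEq] at h
      subst h
      have hx1 := MI.mem_exp hS h1 hC.ha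
      have hx2 : MI.mem S (Real.exp (2 * a)) X2 :=
        mem_of_eq (MI.mem_exp hS h2 (MI.mem_mulInt hC.ha 2)) (by push_cast; ring_nf)
      have hx3 : MI.mem S (Real.exp (-(2 * a))) X3 :=
        mem_of_eq (MI.mem_exp hS h3 (MI.mem_mulInt hC.ha (-2))) (by push_cast; ring_nf)
      have hEm := MI.mem_divPos hS hE hx1 (MI.mem_sub hx2 hx3)
      rw [weilArchDensity_two_mul]
      exact MI.mem_mul hS hC.ha (MI.mem_add (by simpa using MI.mem_ofInt S 1) hEm)
    · simp at h
  · simp at h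

/-! ## `AOP ∋ A_op⁺(a)` -/

/-- The floors `n_i = ⌊2a/ℓ_i⌋` decided on the boxes: `n_i·lens_i.hi ≤ 2·A.lo` and `2·A.hi < (n_i+1)·lens_i.lo`.
[cite: Moore1966, Ch. 3 (interval arithmetic: inclusion property)] -/
def checkFloors (C : Consts) (ns : List ℕ) : Bool :=
  decide (ns.length = C.lens.length) &&
    (List.range C.lens.length).all fun i ↦
      decide (((ns.getD i 0 : ℕ) : ℤ) * (C.lens.getD i default).hi ≤ 2 * C.A.lo) &&
        decide (2 * C.A.hi < (((ns.getD i 0 : ℕ) : ℤ) + 1) * (C.lens.getD i default).lo)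

/-- `Σ_{i<m} wts_i · 2 · Re e^{iπ/(n_i+2)}` — box of the partial sums of `A_op⁺`. [cite: Yoshida1992HermitianForms, §7 pp. 305–312] -/
def aopSum (S K k : ℕ) (C : Consts) (ns : List ℕ) : ℕ → Option MI
  | 0 => some (MI.ofInt S 0)
  | i + 1 =>
    match aopSum S K k C ns i, MC.expI S K k C.P (C.P.divNat (ns.getD i 0 + 2)) with
    | some acc, some Z => some (acc.add (((C.wts.getD i default).mul S Z.re).mulInt 2))
    | _, _ => none

/-- Box of `A_op⁺(a)`. [cite: Yoshida1992HermitianForms, §7 pp. 305–312] -/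
def aopBox (S K k : ℕ) (C : Consts) (ns : List ℕ) : Option MI := aopSum S K k C ns C.wts.length

/-- From the checked boxes: `⌊2a/ℓ_i⌋₊ = n_i`. [cite: Moore1966, Ch. 3 (interval arithmetic: inclusion property)] -/
theorem floor_eq_of_checkFloors (hS : 0 < S) (ha0 : 0 < a) {ks : List PrimeLen} (hks : PrimeData a ks) {C : Consts}
    (hC : ConstsValid S a ks C) {ns : List ℕ} (h : checkFloors C ns = true) {i : ℕ} (hi : i < ks.length) :
    ⌊2 * a / (ks.getD i default).len⌋₊ = ns.getD i 0 := by
  unfold checkFloors at h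
  simp only [Bool.and_eq_true, decide_eq_true_eq, List.all_eq_true, List.mem_range] at h
  obtain ⟨-, hall⟩ := h
  have hi' : i < C.lens.length := by rw [hC.lens_len]; exact hi
  obtain ⟨h1, h2⟩ := hall i hi'
  have hℓ := hC.lens i hi
  have hA := hC.ha
  have hSr : (0 : ℝ) < S := by exact_mod_cast hS
  -- `ℓ_i > 0`
  have hℓpos : 0 < (ks.getD i default).len := by
    have hmem : ks.getD i default ∈ ks := by
      rw [List.getD_eq_getElem _ _ hi]; exact List.getElem_mem hi
    obtain ⟨hp, he⟩ := hks.prime _ hmem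
    unfold PrimeLen.len
    have : (1 : ℝ) < (ks.getD i default).p := by exact_mod_cast hp.one_lt
    have := Real.log_pos this
    have he' : (0 : ℝ) < (ks.getD i default).e := by exact_mod_cast he
    positivity
  set ℓ := (ks.getD i default).len with hℓdef
  set n := ns.getD i 0 with hndef
  have h1' : ((n : ℤ) : ℝ) * ((C.lens.getD i default).hi : ℝ) ≤ 2 * (C.A.lo : ℝ) := by exact_mod_cast h1
  have h2' : 2 * (C.A.hi : ℝ) < (((n : ℤ) : ℝ) + 1) * ((C.lens.getD i default).lo : ℝ) := by exact_mod_cast h2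
  have hlo : (n : ℝ) * ℓ ≤ 2 * a := by
    have e1 : (n : ℝ) * (ℓ * S) ≤ (n : ℝ) * (C.lens.getD i default).hi := mul_le_mul_of_nonneg_left hℓ.2 (by positivity)
    push_cast at h1'
    nlinarith [hA.1]
  have hhi : 2 * a < ((n : ℝ) + 1) * ℓ := by
    have e1 : ((n : ℝ) + 1) * (C.lens.getD i default).lo ≤ ((n : ℝ) + 1) * (ℓ * S) :=
      mul_le_mul_of_nonneg_left hℓ.1 (by positivity)
    push_cast at h2'
    nlinarith [hA.2]
  rw [Nat.floor_eq_iff (by positivity)]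
  exact ⟨by rw [le_div_iff₀ hℓpos]; exact hlo, by rw [div_lt_iff₀ hℓpos]; exact hhi⟩

/-- Soundness of `aopSum`. [cite: Moore1966, Ch. 3 (interval arithmetic: inclusion property)] -/
theorem mem_aopSum (hS : 0 < S) {ks : List PrimeLen} {C : Consts} (hC : ConstsValid S a ks C) {K k : ℕ} (ns : List ℕ) :
    ∀ i, i ≤ ks.length → ∀ {Y : MI}, aopSum S K k C ns i = some Y →
      MI.mem S (∑ j ∈ Finset.range i, (ks.getD j default).wt * (2 * Real.cos (π / ((ns.getD j 0 : ℕ) + 2)))) Y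
  | 0, _, Y, h => by
      simp only [aopSum, Option.some.injEq] at h
      subst h
      simpa using MI.mem_ofInt S 0
  | i + 1, hi, Y, h => by
      simp only [aopSum] at h
      split at h
      · rename_i acc Z hacc hZ
        simp only [Option.some.injEq] at h
        subst h
        rw [Finset.sum_range_succ]
        have hrec := mem_aopSum hS hC ns i (by omega) hacc
        have hθ : MI.mem S (π / ((ns.getD i 0 : ℕ) + 2 : ℕ)) (C.P.divNat (ns.getD i 0 + 2)) :=
          MI.mem_divNat hC.pi (by omega)
        have hZm := (MC.mem_expI hS hC.pi hZ hθ).1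
        rw [Complex.exp_ofReal_mul_I_re] at hZm
        refine MI.mem_add hrec (mem_of_eq (MI.mem_mulInt (MI.mem_mul hS (hC.wts i hi) hZm) 2) ?_)
        push_cast
        ring
      · simp at h

/-- ★ **Soundness of `aopBox`**: with the floors checked, `A_op⁺(a) ∈ AOP`. [cite: Yoshida1992HermitianForms, §7 pp. 305–312] -/
theorem mem_aopBox (hS : 0 < S) (ha0 : 0 < a) {ks : List PrimeLen} (hks : PrimeData a ks) {C : Consts}
    (hC : ConstsValid S a ks C) {K k : ℕ} {ns : List ℕ} (hfl : checkFloors C ns = true) {AOP : MI}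
    (h : aopBox S K k C ns = some AOP) :
    MI.mem S (∑ j ∈ weilPrimeIndex a, (Λ j : ℝ) / Real.sqrt j * (2 * Real.cos (π / (⌊2 * a / Real.log j⌋₊ + 2)))) AOP := by
  have hsum : (∑ j ∈ weilPrimeIndex a, (Λ j : ℝ) / Real.sqrt j * (2 * Real.cos (π / (⌊2 * a / Real.log j⌋₊ + 2)))) =
      ∑ j ∈ Finset.range ks.length, (ks.getD j default).wt * (2 * Real.cos (π / ((ns.getD j 0 : ℕ) + 2))) := by
    rw [sum_weilPrimeIndex_eq_listSum hks (fun j ↦ 2 * Real.cos (π / (⌊2 * a / Real.log j⌋₊ + 2))),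
      list_sum_map_eq_sum_range]
    refine Finset.sum_congr rfl fun j hj ↦ ?_
    rw [PrimeLen.log_val, floor_eq_of_checkFloors hS ha0 hks hC hfl (Finset.mem_range.mp hj)]
  rw [hsum]
  unfold aopBox at h
  rw [hC.wts_len] at h
  exact mem_aopSum hS hC ns ks.length le_rfl h

end TwistedEncl

end Summit.Ventures.WeilGRH
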